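import Literature.Topology.FourManifolds.K2LiteBand
import HarnessLib

/-!
# The band-coordinate K₂ track of a band core with a free descent slope

Topic `Literature/Topology/FourManifolds`; fact seat `provefact-IsStrictHandleSlide.isSurgery`
(R. C. Kirby, *The Topology of 4-Manifolds*, LNM 1374 (1989), Ch. I §4, Fig. 4.2; remaining content:
the named fact (S) `Literature.Topology.FourManifolds.FramedLink.IsStrictHandleSlide.slideModel`).
`K2LiteBand.lean` fixes the descent slope of the track at `liteMs = 2 MH / vmin`; the monotonicity
of the route in the twisted meridian chart (`RouteMonotone.lean`, condition COND5) needs the slope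
as large as dictated by the strip geometry. This file is the same construction with the slope
`m_s ≥ liteMs` as a parameter (`BandCore.k2liteGen`, admissible tip depths
`κ_D ≤ liteKmaxGen m_s = min (1/8, 1/(101 m_s))`) and the same reshaping isotopy
(`BandCore.exists_ambientIsotopy_k2liteGen`, from `exists_ambientIsotopy_lowerTrack'`).

## References

* R. C. Kirby, *The Topology of 4-Manifolds*, LNM 1374, Springer (1989), Ch. I §4. [Kirby1989]
-/

open scoped Manifold ContDiff Topology
open Set Real Filter Function

noncomputable section

namespace Literature.Topology.FourManifolds

namespace BandCore

variable {A B : Knot} {avoid : Set (Metric.sphere (0 : EuclideanSpace ℝ (Fin 4)) 1)} (c : BandCore A B avoid)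

/-- **The largest admissible tip depth for the slope `m_s`**: `min (1/8, 1/(101 m_s))`. [folklore] -/
def liteKmaxGen (ms : ℝ) : ℝ := min (8⁻¹ : ℝ) (101⁻¹ / ms)

/-- `liteKmaxGen_le` (auxiliary). [folklore] -/
theorem liteKmaxGen_le (ms : ℝ) : liteKmaxGen ms ≤ 8⁻¹ := min_le_left _ _

/-- `liteKmaxGen_le'` (auxiliary). [folklore] -/
theorem liteKmaxGen_le' (ms : ℝ) (_hms : 0 < ms) : liteKmaxGen ms ≤ 101⁻¹ / ms := min_le_right _ _

/-- `liteKmaxGen_pos` (auxiliary). [folklore] -/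
theorem liteKmaxGen_pos {ms : ℝ} (hms : 0 < ms) : 0 < liteKmaxGen ms :=
  lt_min (by norm_num) (div_pos (by norm_num) hms)

/-! ### The track data of the band core -/

/-- **The band-coordinate lower track of the band core with free descent slope** `m_s ≥ liteMs`, tip
depth `κ_D ≤ liteKmaxGen m_s`, landing width `εℓ` and bend width `u₁`. [cite: Kirby1989, Ch. I §4] -/
def k2liteGen {ms κD εℓ u₁ : ℝ} (hms : c.liteMs ≤ ms) (hκ : 0 < κD) (hκ' : κD ≤ liteKmaxGen ms) (hε : 0 < εℓ) (hε' : 4 * εℓ ≤ κD)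
    (hu : 0 < u₁) (hu' : u₁ ≤ κD) : K2LiteData where
  a := c.alo + c.epsLo
  b := c.tlo - c.epsLo
  ε := c.epsLo
  f := c.fLo
  g := c.gLo
  ch := 3 / 20
  κ₀ := 2⁻¹
  hpl := (c.fLo (c.alo + c.epsLo) + c.fLo (c.tlo - c.epsLo - c.epsLo)) / 2
  hr0 := c.liteHr0
  hr1 := c.liteHr1
  κD := κD
  εℓ := εℓ
  u₁ := u₁
  ms := ms
  vmin := c.liteVmin
  MH := c.liteMH
  ε_pos := c.epsLo_pos'
  hab := by linarith [c.alo_add_lt_tlo_sub]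
  f_smooth := c.fLo_spec.1
  g_smooth := c.gLo_spec.1
  f_deriv_pos := fun t ht ↦ c.fLo_spec.2.2.1 t (by linarith [c.marks_lt.2.2.2.1, c.marks_lt.2.2.2.2.1, c.marks_lt.2.2.2.2.2.1])
  g_deriv_neg := fun t ht ↦ c.cLo_hyp.2.2.2 t (by linarith)
  ch_pos := by norm_num
  κ₀_pos := by norm_num
  κ₀_le := le_rfl
  hpl_gt := by
    have := c.fLo_lt_fLo (show c.alo + c.epsLo < c.tlo - c.epsLo - c.epsLo by linarith [c.alo_add_lt_tlo_sub, c.epsLo_pos'])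
      (by linarith [c.epsLo_pos'])
    linarith
  hpl_le := by
    have h1 := c.fLo_lt_fLo (show c.alo + c.epsLo < c.tlo - c.epsLo - c.epsLo by linarith [c.alo_add_lt_tlo_sub, c.epsLo_pos'])
      (by linarith [c.epsLo_pos'])
    have h2 := c.fLo_le_fLo (show c.tlo - c.epsLo - c.epsLo ≤ c.tlo - c.epsLo - c.epsLo / 2 by linarith [c.epsLo_pos'])
      (by linarith [c.epsLo_pos'])
    rw [liteHr0]; linarith
  hr0_gt := by
    have h2 := c.fLo_le_fLo (show c.tlo - c.epsLo - c.epsLo ≤ c.tlo - c.epsLo - c.epsLo / 2 by linarith [c.epsLo_pos'])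
      (by linarith [c.epsLo_pos'])
    rw [liteHr0]; linarith
  hr_lt := c.liteHr_lt
  hr1_le := by rw [liteHr1]; linarith
  κD_pos := hκ
  κD_le := by linarith [hκ'.trans (liteKmaxGen_le ms)]
  κD_small := by linarith [hκ'.trans (liteKmaxGen_le ms)]
  εℓ_pos := hε
  εℓ_le := hε'
  u₁_pos := hu
  u₁_le := hu'
  ms_pos := c.liteMs_pos.trans_le hms
  vmin_pos := c.liteVmin_spec.1
  vmin_le := fun t ht hS ↦ c.liteVmin_spec.2 t ht (by
    have hk := hκ'.trans (liteKmaxGen_le ms)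
    have e : c.liteHh t = c.fLo t + 3 / 20 * smoothStep (c.tlo - c.epsLo - c.epsLo) (c.tlo - c.epsLo - c.epsLo / 2) t := rfl
    rw [e]
    exact ⟨by linarith [hS.1], by linarith [hS.2]⟩)
  MH_ge := c.liteMH_spec
  ms_large := by
    have h := c.liteMs_mul
    nlinarith [mul_le_mul_of_nonneg_right hms c.liteVmin_spec.1.le]
  f_lo := fun t ht ↦ by
    have := (c.fLo_mem_window (t := t) ⟨by linarith [ht.1, c.epsLo_pos'], by linarith [ht.2]⟩).1
    linarith
  f_hi := fun t ht ↦ by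
    have := (c.fLo_mem_window (t := t) ⟨by linarith [ht.1, c.epsLo_pos'], by linarith [ht.2]⟩).2
    linarith
  g_mem := fun t ht ↦ by
    have h := c.gLo_mem (t := t) (by linarith [ht.2, c.tlo_marksB.1])
    exact ⟨h.1, by linarith [h.2]⟩
  gap := fun t ht ↦ by
    have hg := c.gLo_le_landing ht.1
    have hf := (c.fLo_mem_window (t := c.tlo - c.epsLo - c.epsLo / 2)
      ⟨by linarith [c.alo_add_lt_tlo_sub, c.epsLo_pos'], by linarith [c.epsLo_pos']⟩).1
    have hmsp : 0 < ms := c.liteMs_pos.trans_le hms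
    have hk : ms * κD ≤ 101⁻¹ := by
      have := hκ'.trans (liteKmaxGen_le' ms hmsp)
      rw [le_div_iff₀ hmsp] at this
      linarith
    rw [liteHr0]; linarith

section

variable {ms κD εℓ u₁ : ℝ} (hms : c.liteMs ≤ ms) (hκ : 0 < κD) (hκ' : κD ≤ liteKmaxGen ms) (hε : 0 < εℓ) (hε' : 4 * εℓ ≤ κD)
  (hu : 0 < u₁) (hu' : u₁ ≤ κD)

/-- The abscissa of the arch is the `smoothStep a b` of the track data. [folklore] -/
theorem cLo_fst_eq_gen (t : ℝ) :
    c.cLo t 0 = smoothStep (c.k2liteGen hms hκ hκ' hε hε' hu hu').a (c.k2liteGen hms hκ hκ' hε hε' hu hu').b t := by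
  rw [c.cLo_apply_zero]; rfl

/-- The height of the arch is the `v` of the track data. [folklore] -/
theorem cLo_snd_eq_v_gen (t : ℝ) : c.cLo t 1 = (c.k2liteGen hms hκ hκ' hε hε' hu hu').v t := by
  rw [c.cLo_apply_one, K2LiteData.v]
  have e1 : (c.k2liteGen hms hκ hκ' hε hε' hu hu').a + (c.k2liteGen hms hκ hκ' hε hε' hu hu').ε = c.alo + 2 * c.epsLo := by
    show c.alo + c.epsLo + c.epsLo = _; ring
  have e2 : (c.k2liteGen hms hκ hκ' hε hε' hu hu').b - (c.k2liteGen hms hκ hκ' hε hε' hu hu').ε = c.tlo - 2 * c.epsLo := by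
    show c.tlo - c.epsLo - c.epsLo = _; ring
  rw [e1, e2]; rfl

/-- **The reshaping isotopy of the lower arch along the band-coordinate track.** See the module
docstring. [cite: Kirby1989, Ch. I §4] -/
theorem exists_ambientIsotopy_k2liteGen (hAB : Disjoint (range ⇑A) (range ⇑B))
    {O : Set (Metric.sphere (0 : EuclideanSpace ℝ (Fin 4)) 1)} (hO : IsOpen O)
    (hOsub : ∀ u ∈ Icc (0 : ℝ) 1, ∀ s ∈ Icc (c.alo + c.epsLo / 2) (c.tlo - c.epsLo / 4),
      c.band (pt2 ((1 - u) * c.cLo s 0 + u * (c.k2liteGen hms hκ hκ' hε hε' hu hu').X₁ s)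
        ((1 - u) * c.cLo s 1 + u * (c.k2liteGen hms hκ hκ' hε hε' hu hu').H₁ s)) ∈ O) :
    ∃ (Θ : AmbientIsotopy (𝓡 3) (Metric.sphere (0 : EuclideanSpace ℝ (Fin 4)) 1)) (k₂ : Knot),
      (∀ t y, y ∉ O → Θ.toFun t y = y) ∧ Θ.toFun 1 ∘ ⇑(c.rebuild hAB) = ⇑k₂ ∧
      (∀ s ∈ Icc (c.alo + c.epsLo / 2) (c.tlo - c.epsLo / 4),
        k₂ (circlePt s) = c.band (pt2 ((c.k2liteGen hms hκ hκ' hε hε' hu hu').X₁ s) ((c.k2liteGen hms hκ hκ' hε hε' hu hu').H₁ s))) ∧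
      (∀ t ∈ Ico c.alo (c.alo + 1), t ∉ Icc (c.alo + c.epsLo / 2) (c.tlo - c.epsLo / 4) →
        k₂ (circlePt t) = c.rebuild hAB (circlePt t)) := by
  set d := c.k2liteGen hms hκ hκ' hε hε' hu hu' with hd
  have hε0 := c.epsLo_pos'
  have hab := c.alo_add_lt_tlo_sub
  have ha : d.a = c.alo + c.epsLo := rfl
  have hb : d.b = c.tlo - c.epsLo := rfl
  have hεd : d.ε = c.epsLo := rfl
  have hI : ∀ {s}, s ∈ Icc (c.alo + c.epsLo / 2) (c.tlo - c.epsLo / 4) →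
      s ∈ Icc (d.a - d.ε / 2) (d.b + 3 * d.ε / 4) := fun hs ↦ by
    rw [ha, hb, hεd]; exact ⟨by linarith [hs.1], by linarith [hs.2]⟩
  refine c.exists_ambientIsotopy_lowerTrack' hAB d.contDiff_X₁ d.contDiff_H₁ ?_ ?_ d.X₁_mem_Icc d.deriv_X₁_nonneg
    ?_ ?_ ?_ ?_ ?_ ?_ ?_ ?_ hO hOsub
  · -- hagreeX
    intro t ht
    rcases le_or_gt t (c.alo + c.epsLo) with h | h
    · rw [d.X₁_of_le_a (by rw [ha]; exact h), c.cLo_fst_eq_zero_of_le h]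
    · have h2 : c.tlo - c.epsLo / 2 ≤ t := by
        by_contra h2; exact ht ⟨h, lt_of_not_ge h2⟩
      rw [d.X₁_of_ge (by rw [hb, hεd]; linarith), c.cLo_fst_eq_one_of_ge (by linarith)]
  · -- hagreeH
    intro t ht
    rcases le_or_gt t (c.alo + c.epsLo) with h | h
    · rw [d.H₁_of_le_a (by rw [ha]; exact h), c.cLo_snd_eq_fLo_of_le (by linarith)]; rfl
    · have h2 : c.tlo - c.epsLo / 2 ≤ t := by
        by_contra h2; exact ht ⟨h, lt_of_not_ge h2⟩
      rw [d.H₁_of_ge (by rw [hb, hεd]; linarith), c.cLo_snd_eq_gLo_of_ge (by linarith)]; rfl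
  · -- hX₁zero
    intro s _ h0
    have := d.le_a_of_X₁_eq_zero h0
    rw [d.H₁_of_le_a this]; rfl
  · -- hX₁lt
    intro t ht
    exact d.X₁_lt_one_of_le (by rw [hb, hεd]; linarith)
  · -- hH₁I
    intro t ht
    exact d.H₁_mem_Ioo (hI ht)
  · -- hH₁ge
    intro t ht hX
    exact d.g_le_H₁ (by rw [hb, hεd]; exact ⟨by linarith [ht.1], by linarith [ht.2]⟩) hX
  · -- hinj₁
    intro s hs t ht h
    apply d.injOn_track (hI hs) (hI ht)
    have h0 : d.X₁ s = d.X₁ t := by simpa using congrArg (fun p : EuclideanSpace ℝ (Fin 2) ↦ p 0) h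
    have h1 : d.H₁ s = d.H₁ t := by simpa using congrArg (fun p : EuclideanSpace ℝ (Fin 2) ↦ p 1) h
    exact Prod.ext h0 h1
  · -- hreg₁
    intro s hs hX
    exact d.deriv_H₁_ne_zero (hI hs) hX
  · -- hco
    intro t ht t' ht' hlt h0 _
    rw [c.cLo_fst_eq_gen hms hκ hκ' hε hε' hu hu', c.cLo_fst_eq_gen hms hκ hκ' hε hε' hu hu'] at h0
    have := d.co_mono (hI ht) (hI ht') hlt h0
    rw [c.cLo_snd_eq_v_gen hms hκ hκ' hε hε' hu hu', c.cLo_snd_eq_v_gen hms hκ hκ' hε hε' hu hu']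
    exact this
  · -- hcoD
    intro s hs hχ' _
    have eχ : (fun t ↦ c.cLo t 0) = smoothStep d.a d.b := funext fun t ↦ c.cLo_fst_eq_gen hms hκ hκ' hε hε' hu hu' t
    have ev : (fun t ↦ c.cLo t 1) = d.v := funext fun t ↦ c.cLo_snd_eq_v_gen hms hκ hκ' hε hε' hu hu' t
    rw [eχ] at hχ'
    rw [ev]
    exact d.co_monoD (hI hs) hχ'

end

end BandCore

end Literature.Topology.FourManifolds
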